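import Mathlib.MeasureTheory.Measure.Support
import Mathlib.Topology.MetricSpace.Thickening
import Literature.Analysis.FunctionSpaces.BesovDifference
import Literature.Analysis.FunctionSpaces.TorusFluidGlue
import Literature.Analysis.FluidPDE.WeakSolution
import Literature.Analysis.FluidPDE.DissipationAnomaly
import HarnessLib

/-!
# The two analytic inputs of De Rosa–Isett's vanishing-viscosity intermittency theorem (Thm. 2.13)

`Literature.Barriers.AnomalousDissipation.IntermittentDissipation` vendors as the named fact
`DeRosaIsett2024_thm213` the Eulerian vanishing-viscosity intermittency theorem of
De Rosa–Isett (ARMA 248 (2024), Thm. 2.13 of arXiv:2212.08176): smooth Navier–Stokes families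
`u_j` on `T^d × (0,T)` with `ν_j → 0`, interior zeroth law and dissipation measures converging
to a measure `D` whose support has space–time Minkowski dimension `≤ γ + 1` blow up in
`L^p_t B^θ_{p,∞}` whenever `2θ/(1-θ) > 1 - (p-3)(d-γ)/p`.

The printed proof (op. cit. §6.1) is a four-line contradiction argument resting on four
inputs: (1) Thm. 2.7, (2) an Aubin–Lions–Simon compactness step, (3) lower semicontinuity of
the `L^p_t B^θ_{p,∞}` norm under the strong limit ("and moreover `v ∈ L^p_t(B^θ_{p,∞})`"), and
(4) the identification `D^v = μ` of the Duchon–Robert distribution of the limit with the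
limiting dissipation measure (op. cit. §2.1; Duchon–Robert 2000, Prop. 4). This file
**decomposes** the fact along that proof (D-0014) and names the two inputs that are neither in
Mathlib nor in the tree, (1) and (2), stated on the flat torus with the accepted notions. Input
(3) is *proved* (`Literature.Analysis.FunctionSpaces.BesovLowerSemicontinuity`, Fatou), and
input (4) is already decomposed in the tree (`Literature.Analysis.FluidPDE.DuchonRobertInviscidLimit`:
the Calderón–Zygmund pressure is the named fact `Torus.exists_pressure_of_tendsto_L3`, the limit
passages are proved); the sibling `IntermittentDissipationProofs` assembles
`DeRosaIsett2024_thm213` from (1), (2) and that pressure fact (all the glue — subsequences, the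
`p = ∞` case, the low dimensions `d ≤ 1`, the support of `D`, positivity of `∫ψ dD` from the
interior zeroth law, and the tested local energy equality of smooth solutions on the open strip
— being proved there).

* `DeRosaIsett2024_thm27` — **Thm. 2.7 (Eulerian intermittency)**, the analytic core: a weak
  Euler solution `v ∈ L^p(0,T; B^θ_{p,∞}(T^d))`, `p ∈ [3,∞)`, whose Duchon–Robert distribution
  `D^v = -[∂ₜ(½|v|²) + div((½|v|² + p)v)]` (op. cit. (Local_energy), §2.1) is supported on a
  closed space–time set `S` with `vol((S)_δ) ≲ δ^{d-γ}` has `D^v ≡ 0` as soon as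
  `2θ/(1-θ) > 1 - (p-3)(d-γ)/p`. Rendered with the pressure-explicit distributional Euler
  predicate `Torus.IsDistributionalNSSolutionOn T 0 0 v p` (`Literature.Analysis.FluidPDE.WeakSolution`)
  and the accepted local energy balance `Torus.HasLocalEnergyBalance T 0 v p 0 D`
  (`Literature.Analysis.FluidPDE.DissipationAnomaly`), which at `ν = 0` reads exactly
  `∫∫ [½|v|²∂ₜψ + (½|v|² + p)⟪v,∇ψ⟫] = D ψ`.
* `DeRosaIsett2024_s61_compactness` — the **Aubin–Lions–Simon step** of §6.1: smooth
  Navier–Stokes solutions with `ν_j → 0`, uniformly bounded in `L^p_t B^θ_{p,∞}` (`θ > 0`,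
  `p ∈ [3,∞)`), have a subsequence converging strongly in `L³((0,T) × T^d)` (Simon 1986, §8,
  Cor. 4, with `X = B^θ_{p,∞} ⊂⊂ B = L^p ⊂ Y = H^{-s}`, the time derivatives being bounded in
  `L¹(0,T;Y)` by the equations and the Calderón–Zygmund bound on the pressure).

## Design notes

* Exponents `p = q ∈ [3, ∞)` only (`q ≠ ∞`): the case `p = ∞` of Thm. 2.13 is *reduced* to
  large finite `p` in the Proofs file (on the probability space `T^d` and the bounded interval
  `(0,T)`, `‖·‖_{L^{p'}_t B^θ_{p',∞}} ≤ T^{1/p'} ‖·‖_{L^∞_t B^θ_{∞,∞}}`, and the strict threshold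
  inequality survives for `p'` large), so neither the facts nor the lower-semicontinuity
  theorem need the `L^∞_t B^θ_{∞,∞}` slice-measurability theory. The paper's integrability
  exponent `p` is the binder `q` (as in the target; `p` is the pressure).
* `DeRosaIsett2024_thm27` keeps the printed `d ≥ 2`; the dimensions `card d ≤ 1`, where the
  target is vacuous (divergence-free fields on `T¹`/`T⁰` have no gradient, so the interior
  zeroth law fails), are handled in the Proofs file. The pressure in `DeRosaIsett2024_thm27` is
  any `L^{3/2}` distributional pressure of `v`: on `T^d` it differs from the Calderón–Zygmund
  pressure `R_iR_j(v_iv_j)` of the printed proof by a function of time alone (uniqueness of the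
  distributional pressure gradient), which changes neither `D^v` (tested against `⟪v, ∇ψ⟫` it
  integrates to zero slice-wise by weak incompressibility) nor the pressure–velocity commutator
  `(pv)_ε - p_εv_ε` of §5.1. "`D^v` supported in `S`" is rendered without a support notion for
  the unbundled `Torus.STFunctional`: `D ψ = 0` for every test `ψ` whose closed support misses
  `S`; the printed hypothesis is on `S = spt D^v` itself, and the Minkowski bound passes to
  supersets of the support only in the direction used here (a bound for `S ⊇ spt D^v` bounds
  the thickenings of `spt D^v`).
* Membership `v ∈ L^p_t B^θ_{p,∞}` is the guarded `MemLpBesovSup` (a.e. slice membership and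
  finite norm), never bare finiteness of `eLpBesovSupNorm` (whose time integrand is the junk
  `0` at slices of infinite Besov norm).
* Strong `L³` convergence and `L^r` bounds are written, as in
  `Literature.Analysis.FluidPDE.DuchonRobertInviscidLimit`, with joint lower Lebesgue integrals
  `∫⁻ t in Ioo 0 T, ∫⁻ x, ‖·‖ₑ ^ r` and measurability of the space–time lift `Torus.stLift`, so
  that the conclusion of `DeRosaIsett2024_s61_compactness` feeds `Torus.exists_pressure_of_tendsto_L3`
  and the limit theorems of that file directly.

## References

* L. De Rosa, P. Isett, *Intermittency and lower dimensional dissipation in incompressible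
  fluids*, Arch. Ration. Mech. Anal. 248 (2024), Paper No. 11; arXiv:2212.08176, read in the
  tex source: §2.1 (the Duchon–Robert distribution and `lim ν|∇v^ν|² = D^v`), Def. 2.5,
  Rem. 2.6, Thm. 2.7, §2.4 and Thm. 2.13, §3.1 (Minkowski convention
  "`H^d((S)_δ) ≲ δ^{d-γ}`"), §5.1 (proof of Thm. 2.7), §6.1 (proof of Thm. 2.13).
  [DeRosaIsett2024]
* J. Simon, *Compact sets in the space `L^p(0,T;B)`*, Ann. Mat. Pura Appl. (4) 146 (1986/87)
  65–96, §8, Cor. 4 (p. 85): "Assume `X ⊂ B ⊂ Y` with compact imbedding `X → B`. Let `F` be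
  bounded in `L^p(0,T;X)` where `1 ≤ p < ∞`, and `∂F/∂t` be bounded in `L¹(0,T;Y)`. Then `F`
  is relatively compact in `L^p(0,T;B)`." [Simon1986]
* J. Duchon, R. Robert, Nonlinearity 13 (2000) 249–255, Prop. 4 (input (4), decomposed in
  `Literature.Analysis.FluidPDE.DuchonRobertInviscidLimit`). [DuchonRobert2000]
-/

open MeasureTheory Set Filter Topology Metric Function
open scoped ENNReal NNReal

noncomputable section

namespace Literature.Barriers.AnomalousDissipation

/-- **De Rosa–Isett, Thm. 2.7 (Eulerian intermittency), flat torus, `p ∈ [3,∞)`.** Let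
`d ≥ 2`, `T > 0`, and let `(v, p)` be a distributional solution of the incompressible Euler
equations on `T^d × (0,T)` (`Torus.IsDistributionalNSSolutionOn T 0 0 v p`: `v ∈ L²`, weakly
divergence free, momentum equation against all smooth vector tests supported in `(0,T)`) with
`p ∈ L^{3/2}((0,T) × T^d)` and `v ∈ L^q(0,T; B^θ_{q,∞}(T^d))` (`MemLpBesovSup q θ q v`) for some
`q ∈ [3, ∞)`, `θ ∈ (0,1)`. Let `D` be the Duchon–Robert distribution of `v`, i.e. the
functional with `∂ₜ(½|v|²) + div((½|v|² + p)v) = -D` in `𝒟'((0,T) × T^d)`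
(`Torus.HasLocalEnergyBalance T 0 v p 0 D`; op. cit. §2.1), and suppose `D` is supported in a
closed space–time set `S ⊆ ℝ × T^d` — `D ψ = 0` for every test `ψ` whose closed support is
disjoint from `S` — of space–time Minkowski dimension at most `γ + 1`, `γ ∈ [0,d]`, in the
sense of op. cit. §3.1/Def. 2.5 with `β = 1`: `vol((S)_δ) ≤ C δ^{d-γ}` for `0 < δ < δ₀`
(sup-metric `δ`-neighbourhoods in `ℝ × T^d`, which contain the Euclidean ones). If
`2θ/(1-θ) > 1 - ((q-3)/q)(d-γ)` (written `1 - (1 - 3/q).toReal·(d-γ) < 2θ/(1-θ)`), then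
`D ≡ 0`: `D ψ = 0` for every smooth `ψ` compactly supported in `(0,T) × T^d`
(De Rosa–Isett 2024, Thm. 2.7; the pressure here is any `L^{3/2}` distributional pressure,
which on `T^d` differs from the Calderón–Zygmund one of the printed proof, §5.1 with §3.4, by a
function of time not seen by `D` nor by the commutator `(pv)_ε - p_εv_ε`; the printed
`p ∈ [3,∞]` is restricted to finite exponents). [cite: DeRosaIsett2024, Thm. 2.7] -/
def DeRosaIsett2024_thm27 : Prop :=
  ∀ (d : Type) [Fintype d] [DecidableEq d] (_hd : 2 ≤ Fintype.card d) (T : ℝ) (_hT : 0 < T)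
    (v : ℝ → UnitAddTorus d → EuclideanSpace ℝ d) (p : ℝ → UnitAddTorus d → ℝ)
    (_hsol : Literature.Analysis.FluidPDE.Torus.IsDistributionalNSSolutionOn T 0 0 v p)
    (_hp : ∫⁻ t in Ioo 0 T, ∫⁻ x, ‖p t x‖ₑ ^ (3 / 2 : ℝ) < ∞)
    (q : ℝ≥0∞) (_hq : 3 ≤ q) (_hq' : q ≠ ∞) (θ : ℝ) (_hθ : 0 < θ ∧ θ < 1)
    (_hv : Literature.Analysis.FunctionSpaces.MemLpBesovSup q θ q v volume (Ioo 0 T))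
    (D : Literature.Analysis.FluidPDE.Torus.STFunctional d)
    (_hD : Literature.Analysis.FluidPDE.Torus.HasLocalEnergyBalance T 0 v p 0 D)
    (S : Set (ℝ × UnitAddTorus d)) (_hS : IsClosed S)
    (_hDS : ∀ ψ : ℝ → UnitAddTorus d → ℝ,
      Literature.Analysis.FunctionSpaces.Torus.IsSpaceTimeTestIoo T ψ →
        Disjoint (tsupport (uncurry ψ)) S → D ψ = 0)
    (γ : ℝ) (_hγ : 0 ≤ γ ∧ γ ≤ Fintype.card d)
    (_hdim : ∃ C : ℝ≥0∞, C ≠ ∞ ∧ ∃ δ₀ : ℝ, 0 < δ₀ ∧ ∀ δ ∈ Ioo 0 δ₀,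
      volume (thickening δ S) ≤ C * ENNReal.ofReal (δ ^ ((Fintype.card d : ℝ) - γ)))
    (_hcond : 1 - (1 - 3 / q).toReal * ((Fintype.card d : ℝ) - γ) < 2 * θ / (1 - θ))
    (ψ : ℝ → UnitAddTorus d → ℝ)
    (_hψ : Literature.Analysis.FunctionSpaces.Torus.IsSpaceTimeTestIoo T ψ),
    D ψ = 0

/-- **The Aubin–Lions–Simon step of De Rosa–Isett's proof of Thm. 2.13** (op. cit. §6.1:
"we can find a subsequence such that `‖v^ν‖_{L^p_t(B^θ_{p,∞})} ≤ C`. In particular, since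
`θ > 0`, by the Aubin–Lions–Simon Lemma we can extract a further subsequence such that
`v^ν → v` in `L^p_{x,t}`"; Simon 1986, §8, Cor. 4 with `X = B^θ_{p,∞}(T^d) ⊂⊂ B = L^p(T^d) ⊂ Y`,
`Y` a negative Sobolev space receiving `∂ₜv^ν = -div(v^ν ⊗ v^ν) - ∇p^ν + νΔv^ν`, bounded in
`L¹(0,T;Y)` by the uniform `L^p_t B^θ_{p,∞}` bound, the Calderón–Zygmund estimate for the
pressure and `ν ≤ sup_j ν_j`). Let `T > 0`, `ν_j > 0` with `ν_j → 0`, and let `(u_j, p_j)` be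
smooth solutions of the unforced Navier–Stokes equations on the open strip `T^d × (0,T)`
(`Torus.IsClassicalNSSolutionOn (Ioo 0 T) (ν_j) 0 (u_j) (p_j)`), uniformly bounded in
`L^q(0,T; B^θ_{q,∞}(T^d))`: `‖u_j‖_{L^q_t B^θ_{q,∞}} ≤ M` for all `j`, for some `q ∈ [3,∞)`,
`θ ∈ (0,1)`, `M < ∞`. Then a subsequence `u_{φ(k)}` converges strongly in `L³((0,T) × T^d)`
to a (jointly a.e.-strongly measurable) field `v ∈ L³((0,T) × T^d)`:
`∫₀ᵀ∫ |u_{φ(k)} - v|³ → 0` (the printed conclusion is convergence in `L^p_{x,t}`, `p = q ≥ 3`,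
to `v ∈ L^p_{x,t}`, which on the finite measure space `(0,T) × T^d` contains this one). [cite: DeRosaIsett2024, §6.1 (proof of Thm. 2.13)] [cite: Simon1986, §8 Cor. 4] -/
def DeRosaIsett2024_s61_compactness : Prop :=
  ∀ (d : Type) [Fintype d] [DecidableEq d] (T : ℝ) (_hT : 0 < T)
    (ν : ℕ → ℝ) (_hν : ∀ j, 0 < ν j) (_hν₀ : Tendsto ν atTop (𝓝 0))
    (u : ℕ → ℝ → UnitAddTorus d → EuclideanSpace ℝ d) (p : ℕ → ℝ → UnitAddTorus d → ℝ)
    (_hNS : ∀ j, Literature.Analysis.FunctionSpaces.Torus.IsClassicalNSSolutionOn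
      (Ioo 0 T) (ν j) 0 (u j) (p j))
    (q : ℝ≥0∞) (_hq : 3 ≤ q) (_hq' : q ≠ ∞) (θ : ℝ) (_hθ : 0 < θ ∧ θ < 1) (M : ℝ≥0)
    (_hM : ∀ j, Literature.Analysis.FunctionSpaces.eLpBesovSupNorm q θ q (u j) volume (Ioo 0 T) ≤ M),
    ∃ (φ : ℕ → ℕ) (v : ℝ → UnitAddTorus d → EuclideanSpace ℝ d), StrictMono φ ∧
      AEStronglyMeasurable (Literature.Analysis.FunctionSpaces.Torus.stLift v)
        (volume.restrict (Ioo 0 T ×ˢ univ)) ∧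
      (∫⁻ t in Ioo 0 T, ∫⁻ x, ‖v t x‖ₑ ^ (3 : ℕ) < ∞) ∧
      Tendsto (fun k => ∫⁻ t in Ioo 0 T, ∫⁻ x, ‖u (φ k) t x - v t x‖ₑ ^ (3 : ℕ)) atTop (𝓝 0)

end Literature.Barriers.AnomalousDissipation

end
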